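/-
Copyright (c) 2026. All rights reserved.
Released under Apache 2.0 license as described in the file LICENSE.
Authors: abc-iut cell, prover seat abc-iut-w5-d097 (wave 5), over the statements of abc-iut-L4-t3.
-/
import Mathlib.Algebra.Category.Grp.Preadditive
import Mathlib.CategoryTheory.Preadditive.FunctorCategory
import Literature.AnabelianGeometry.AbsoluteAnabelian.LogFrobeniusObservablesTSIotaSquare
import HarnessLib

/-!
# [AbsTopIII] Corollary 5.5 (iii), `TS`-half: the universal closures of `Cor55ObservablesTS`,
# `Cor55ObservablesCompatible`, `Cor55ObservablesTelecoreCompatible` REFUTED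

S. Mochizuki, *Topics in absolute anabelian geometry III: global reconstruction algorithms*,
J. Math. Sci. Univ. Tokyo 22 (2015) 939–1156 [MochizukiAbsTopIII2015]; locators = pages of the author's manuscript
(`paper:url-5493eb38cbb7`): Def 5.4 (iii) p. 126 (`Γ⃗^log_non`, "a commutative diagram"), (vii) p. 128 (the `TS`-valued
`ι_{v,ε}`), Cor 5.5 (iii) p. 131 ("respectively … a structure of observable `S_log`").

PROOF-ONLY companion (theorems only; nothing restated) of abc-iut-L4-t3's `LogFrobeniusObservables.lean` (`Cor55ObservablesTS`
= FACT-LIST F-3080, `Cor55ObservablesCompatible` = F-3081) and `LogFrobeniusObservablesTelecore.lean`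
(`Cor55ObservablesTelecoreCompatible` = F-3757), continuing this seat's `LogFrobeniusObservablesTSIotaSquare.lean` (p429468:
the NECESSITY of the `TS`-diamond law) exactly as abc-iut-f-101's `LogFrobeniusObservablesIotaSquare.lean` (p428576) does
for the `⊞`-half (F-0142):

* `TSHomotopies.iota_comp_eq_of_isLogObservableTS` — the cast-free (`HEq`) form of the `TS`-diamond law;
* `exists_not_cor55ObservablesTS_of_preadditive` / `exists_not_cor55ObservablesTS` — over every index set with a
  nonarchimedean place there are a setting `L` and `TS`-homotopies `T` violating the diamond: f-101's modified diagonal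
  setting on a preadditive `C` (`ι⊞ := 0` on the edge into `k̄^×`, the identification `Λ_ν ∘ 𝟭 = 𝟭` elsewhere) with the
  `TS`-homotopies obtained by whiskering the SAME recipe along `𝒩⊞_v → 𝒩_v = 𝟭` (so `iota_toTS` holds by `rfl`); at
  `C := AddCommGrpCat`, `x₀ := ℤ` the diamond reads `0 ≫ 𝟙 ≠ 𝟙 ≫ 𝟙`.  Hence `¬ Cor55ObservablesTS`, and a fortiori
  `¬ Cor55ObservablesCompatible`, `¬ Cor55ObservablesTelecoreCompatible`, there;
* `not_forall_cor55ObservablesTS`, `not_forall_cor55ObservablesCompatible`, `not_forall_cor55ObservablesTelecoreCompatible`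
  — the three rows as CLOSED statements (quantified over the interface and `T`) are false: they are ASSUMPTIONS on
  `(L, T)` (print's Cor 5.5 (iii) for the genuine theaters) whose interface-level content at the places where they can
  fail is the `TS` ι-diamond law of Def 5.4 (iii).

HONEST LABEL: a DEGENERATE consistency witness (no arithmetic content), calibrating the typed statements only.
Refereed pre-IUT material; nothing here bears on [IUTchIII] Cor. 3.12; OUR kernel check; no side taken.
-/

set_option autoImplicit false

universe u

open CategoryTheory Quiver

namespace Literature.AnabelianGeometry.AbsoluteAnabelian

namespace LogFrobeniusSetting

variable {Vmod : Type u} {isArc : Vmod → Bool} (L : LogFrobeniusSetting Vmod isArc)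

/-! ## The `TS`-diamond law, cast-free form -/

namespace TSHomotopies

variable {L} (T : L.TSHomotopies)

/-- **The `TS`-diamond law, `HEq` form**: for an observable `S_log` as typed and a diamond of edges of `Γ⃗^log_v` among
pre-log vertices, any plain morphisms `m₁, m₂, m₃, m₄` between the values `λ_{v,ν}(X₀)` that are (heterogeneously) the
components of `ι_{ε₁}, ι_{ε₂}, ι_{ε₃}, ι_{ε₄}` satisfy `m₁ ≫ m₂ = m₃ ≫ m₄`.
[cite: MochizukiAbsTopIII2015, Cor 5.5 (iii) p. 131] -/
theorem iota_comp_eq_of_isLogObservableTS (v : Vmod) {H : (L.logDiagramTS v).HomotopyFamily}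
    (hH : L.IsLogObservableTS T v H) {νa νb νc νd : LogVertex (isArc v)} (ha : νa.isPostLog = false)
    (hb : νb.isPostLog = false) (hc : νc.isPostLog = false) (hd : νd.isPostLog = false)
    (ε₁ : LogEdgeTS (isArc v) νa νb) (ε₂ : LogEdgeTS (isArc v) νb νd) (ε₃ : LogEdgeTS (isArc v) νa νc)
    (ε₄ : LogEdgeTS (isArc v) νc νd) (X₀ : L.X)
    (m₁ : (L.lam v νa ⋙ L.forget v).obj X₀ ⟶ (L.lam v νb ⋙ L.forget v).obj X₀)
    (m₂ : (L.lam v νb ⋙ L.forget v).obj X₀ ⟶ (L.lam v νd ⋙ L.forget v).obj X₀)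
    (m₃ : (L.lam v νa ⋙ L.forget v).obj X₀ ⟶ (L.lam v νc ⋙ L.forget v).obj X₀)
    (m₄ : (L.lam v νc ⋙ L.forget v).obj X₀ ⟶ (L.lam v νd ⋙ L.forget v).obj X₀)
    (hm₁ : HEq m₁ ((T.iota v ε₁).app X₀)) (hm₂ : HEq m₂ ((T.iota v ε₂).app X₀))
    (hm₃ : HEq m₃ ((T.iota v ε₃).app X₀)) (hm₄ : HEq m₄ ((T.iota v ε₄).app X₀)) :
    m₁ ≫ m₂ = m₃ ≫ m₄ := by
  have ta := L.lam_forget_obj_eq_twist_obj v ha X₀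
  have tb := L.lam_forget_obj_eq_twist_obj v hb X₀
  have tc := L.lam_forget_obj_eq_twist_obj v hc X₀
  rw [(conj_eqToHom_iff_heq m₁ _ ta rfl).mpr hm₁, (conj_eqToHom_iff_heq m₂ _ tb rfl).mpr hm₂,
    (conj_eqToHom_iff_heq m₃ _ ta rfl).mpr hm₃, (conj_eqToHom_iff_heq m₄ _ tc rfl).mpr hm₄]
  simp only [eqToHom_refl, Category.comp_id, Category.assoc]
  rw [T.iota_diamond_of_isLogObservableTS v hH ha hb hc hd ε₁ ε₂ ε₃ ε₄ X₀]

/-- The `HEq` form under `Cor55ObservablesTS T` (F-3080). [cite: MochizukiAbsTopIII2015, Cor 5.5 (iii) p. 131] -/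
theorem iota_comp_eq_of_cor55ObservablesTS (h : L.Cor55ObservablesTS T) (v : Vmod)
    {νa νb νc νd : LogVertex (isArc v)} (ha : νa.isPostLog = false) (hb : νb.isPostLog = false)
    (hc : νc.isPostLog = false) (hd : νd.isPostLog = false) (ε₁ : LogEdgeTS (isArc v) νa νb)
    (ε₂ : LogEdgeTS (isArc v) νb νd) (ε₃ : LogEdgeTS (isArc v) νa νc) (ε₄ : LogEdgeTS (isArc v) νc νd) (X₀ : L.X)
    (m₁ : (L.lam v νa ⋙ L.forget v).obj X₀ ⟶ (L.lam v νb ⋙ L.forget v).obj X₀)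
    (m₂ : (L.lam v νb ⋙ L.forget v).obj X₀ ⟶ (L.lam v νd ⋙ L.forget v).obj X₀)
    (m₃ : (L.lam v νa ⋙ L.forget v).obj X₀ ⟶ (L.lam v νc ⋙ L.forget v).obj X₀)
    (m₄ : (L.lam v νc ⋙ L.forget v).obj X₀ ⟶ (L.lam v νd ⋙ L.forget v).obj X₀)
    (hm₁ : HEq m₁ ((T.iota v ε₁).app X₀)) (hm₂ : HEq m₂ ((T.iota v ε₂).app X₀))
    (hm₃ : HEq m₃ ((T.iota v ε₃).app X₀)) (hm₄ : HEq m₄ ((T.iota v ε₄).app X₀)) :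
    m₁ ≫ m₂ = m₃ ≫ m₄ := by
  obtain ⟨H, hH⟩ := h v
  exact T.iota_comp_eq_of_isLogObservableTS v hH ha hb hc hd ε₁ ε₂ ε₃ ε₄ X₀ m₁ m₂ m₃ m₄ hm₁ hm₂ hm₃ hm₄

end TSHomotopies

/-! ## The witness: `TS`-homotopies violating the diamond -/

section Casts

variable {C : Type (u + 1)} [Category.{u} C]

/-- `Λ_ν ∘ 𝟭 = 𝟭` for `log = 𝟭`. [cite: MochizukiAbsTopIII2015, Def 5.4 (vii) p. 128] -/
private theorem frobeniusTwist_id_comp_id'' (b : Bool) : frobeniusTwist (𝟭 C) b ⋙ 𝟭 C = 𝟭 C := by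
  cases b <;> rfl

/-- An identity is `HEq` to the component of the `eqToHom` of an equation of endofunctors ending at `𝟭`, whiskered
along `𝟭`. [folklore] -/
private theorem heq_id_whiskerRight_eqToHom_app {F : C ⥤ C} (h : F = 𝟭 C) (x : C) :
    HEq (𝟙 x) ((Functor.whiskerRight (eqToHom h : F ⟶ 𝟭 C) (𝟭 C)).app x) := by
  subst h
  rw [eqToHom_refl, Functor.whiskerRight_id']
  rfl

variable [Preadditive C]

/-- A zero endomorphism is `HEq` to the component of the zero natural transformation whiskered along `𝟭`.
[folklore] -/
private theorem heq_zero_whiskerRight_app {F : C ⥤ C} (h : F = 𝟭 C) (x : C) :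
    HEq (0 : x ⟶ x) ((Functor.whiskerRight (0 : F ⟶ 𝟭 C) (𝟭 C)).app x) := by
  subst h
  rw [Functor.whiskerRight_app, NatTrans.app_zero, Functor.id_map]
  rfl

end Casts

variable (Vmod isArc)

/-- **The universal closure of `Cor55ObservablesTS` (F-3080) is REFUTED at every index set with a nonarchimedean
place**, on any preadditive large category `C` with an object `x₀`, `𝟙 x₀ ≠ 0`: abc-iut-f-101's modified diagonal
setting (`ι⊞_{v,ε} := 0` on the nonarchimedean edge into `k̄^×`, the identification `Λ_ν ∘ 𝟭 = 𝟭` on every other edge)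
carries `TS`-homotopies by the same recipe whiskered along `𝒩⊞_v → 𝒩_v = 𝟭` (Def 5.4 (vii): "`ι⊞_{v,ε}` pushed down to
`𝒩_v`" holds by `rfl`), and its `TS`-diamond at a nonarchimedean `v₀` reads `0 ≫ 𝟙 ≠ 𝟙 ≫ 𝟙`; so no observable `S_log`
exists at `v₀` (`TSHomotopies.iota_comp_eq_of_cor55ObservablesTS`), and a fortiori neither the compatibility clause for
the cores nor the one for the telecore holds.  DEGENERATE consistency witness (no arithmetic content).
[cite: MochizukiAbsTopIII2015, Cor 5.5 (iii) p. 131] -/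
theorem exists_not_cor55ObservablesTS_of_preadditive (C : Type (u + 1)) [Category.{u} C] [Preadditive C]
    (x₀ : C) (hx₀ : (𝟙 x₀ : x₀ ⟶ x₀) ≠ 0) (v₀ : Vmod) (hv₀ : isArc v₀ = false) :
    ∃ (L : LogFrobeniusSetting Vmod isArc) (T : L.TSHomotopies), L.X = C ∧ ¬ L.Cor55ObservablesTS T ∧
      ¬ L.Cor55ObservablesCompatible T ∧ ¬ L.Cor55ObservablesTelecoreCompatible T := by
  -- the discriminator of the target vertex `k̄^×` at nonarchimedean places (as in f-101's witness)
  let isMult : (b : Bool) → LogVertex b → Bool := fun b =>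
    match b with
    | false => fun ν => decide ((show NonarchVertex from ν) = NonarchVertex.mult)
    | true => fun _ => false
  let L₀ : LogFrobeniusSetting Vmod isArc :=
    { X := C
      E := C
      proj := 𝟭 C
      log := 𝟭 C
      logIsoId := Iso.refl _
      logOver := Iso.refl _
      Nplus := fun _ => C
      N := fun _ => C
      forget := fun _ => 𝟭 C
      toE := fun _ => 𝟭 C
      lam := fun _ _ => 𝟭 C
      lamOver := fun _ _ => Iso.refl _
      lam_spaceLink_eq_postLog := fun _ => rfl
      iota := fun v ν₁ ν₂ _ =>
        if isMult (isArc v) ν₂ then 0 else eqToHom (frobeniusTwist_id_comp_id'' (C := C) ν₁.isPostLog)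
      An := C
      κAn := CategoryTheory.Equivalence.refl
      φAn := 𝟭 C
      φAn_isEquivalence := inferInstance
      ηAn := Iso.refl _
      κAn₂ := CategoryTheory.Equivalence.refl
      Emono := C
      monoAn := 𝟭 C
      NmonoPlus := fun _ => C
      Nmono := fun _ => C
      forgetMono := fun _ => 𝟭 C
      toEmono := fun _ => 𝟭 C
      monoNplus := fun _ => 𝟭 C
      monoN := fun _ => 𝟭 C
      monoHomotopy := fun _ => Iso.refl _
      AnMono := C
      κAnMono := CategoryTheory.Equivalence.refl
      ψAnMono := fun _ _ => 𝟭 C }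
  let T₀ : L₀.TSHomotopies :=
    { iota := fun v ν₁ ν₂ _ =>
        Functor.whiskerRight
          (if isMult (isArc v) ν₂ then (0 : frobeniusTwist (𝟭 C) ν₁.isPostLog ⋙ 𝟭 C ⟶ 𝟭 C)
            else eqToHom (frobeniusTwist_id_comp_id'' (C := C) ν₁.isPostLog)) (𝟭 C)
      iota_toTS := fun _ _ _ _ => rfl }
  have hTS : ¬ L₀.Cor55ObservablesTS T₀ := by
    intro hobs
    apply hx₀
    -- the nonarchimedean diamond at `v₀`, with the discriminator values, transported along `isArc v₀ = false`
    have key : ∀ b : Bool, b = false → ∃ (νa νb νc νd : LogVertex b) (_ : νa.isPostLog = false)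
        (_ : νb.isPostLog = false) (_ : νc.isPostLog = false) (_ : νd.isPostLog = false),
        isMult b νb = true ∧ isMult b νc = false ∧ isMult b νd = false ∧
        Nonempty (LogEdgeTS b νa νb) ∧ Nonempty (LogEdgeTS b νb νd) ∧ Nonempty (LogEdgeTS b νa νc) ∧
          Nonempty (LogEdgeTS b νc νd) := by
      intro b hb
      subst hb
      exact ⟨NonarchVertex.units, NonarchVertex.mult, NonarchVertex.shellCod, NonarchVertex.perf, rfl, rfl, rfl,
        rfl, rfl, rfl, rfl, ⟨.unitsToMult⟩, ⟨.multToPerf⟩, ⟨.shell⟩, ⟨.shellCodToPerf⟩⟩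
    obtain ⟨νa, νb, νc, νd, ha, hb, hc, hd, ib, ic, id', ⟨ε₁⟩, ⟨ε₂⟩, ⟨ε₃⟩, ⟨ε₄⟩⟩ := key (isArc v₀) hv₀
    have hsq := T₀.iota_comp_eq_of_cor55ObservablesTS hobs v₀ ha hb hc hd ε₁ ε₂ ε₃ ε₄ x₀
      (0 : x₀ ⟶ x₀) (𝟙 x₀) (𝟙 x₀) (𝟙 x₀) ?_ ?_ ?_ ?_
    · change (0 : x₀ ⟶ x₀) ≫ 𝟙 x₀ = 𝟙 x₀ ≫ 𝟙 x₀ at hsq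
      simpa using hsq.symm
    · show HEq (0 : x₀ ⟶ x₀) ((Functor.whiskerRight (if isMult (isArc v₀) νb then
        (0 : frobeniusTwist (𝟭 C) νa.isPostLog ⋙ 𝟭 C ⟶ 𝟭 C)
        else eqToHom (frobeniusTwist_id_comp_id'' (C := C) νa.isPostLog)) (𝟭 C)).app x₀)
      rw [if_pos ib]
      exact heq_zero_whiskerRight_app (frobeniusTwist_id_comp_id'' (C := C) νa.isPostLog) x₀
    · show HEq (𝟙 x₀) ((Functor.whiskerRight (if isMult (isArc v₀) νd then
        (0 : frobeniusTwist (𝟭 C) νb.isPostLog ⋙ 𝟭 C ⟶ 𝟭 C)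
        else eqToHom (frobeniusTwist_id_comp_id'' (C := C) νb.isPostLog)) (𝟭 C)).app x₀)
      rw [if_neg (by simp [id'])]
      exact heq_id_whiskerRight_eqToHom_app (frobeniusTwist_id_comp_id'' (C := C) νb.isPostLog) x₀
    · show HEq (𝟙 x₀) ((Functor.whiskerRight (if isMult (isArc v₀) νc then
        (0 : frobeniusTwist (𝟭 C) νa.isPostLog ⋙ 𝟭 C ⟶ 𝟭 C)
        else eqToHom (frobeniusTwist_id_comp_id'' (C := C) νa.isPostLog)) (𝟭 C)).app x₀)
      rw [if_neg (by simp [ic])]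
      exact heq_id_whiskerRight_eqToHom_app (frobeniusTwist_id_comp_id'' (C := C) νa.isPostLog) x₀
    · show HEq (𝟙 x₀) ((Functor.whiskerRight (if isMult (isArc v₀) νd then
        (0 : frobeniusTwist (𝟭 C) νc.isPostLog ⋙ 𝟭 C ⟶ 𝟭 C)
        else eqToHom (frobeniusTwist_id_comp_id'' (C := C) νc.isPostLog)) (𝟭 C)).app x₀)
      rw [if_neg (by simp [id'])]
      exact heq_id_whiskerRight_eqToHom_app (frobeniusTwist_id_comp_id'' (C := C) νc.isPostLog) x₀
  refine ⟨L₀, T₀, rfl, hTS, fun h => hTS ?_, fun h => hTS (L₀.cor55ObservablesTS_of_telecoreCompatible T₀ h)⟩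
  obtain ⟨K, -, hobs⟩ := h
  exact fun v => by obtain ⟨H, hH, -⟩ := hobs v; exact ⟨H, hH⟩

/-- **F-3080 / F-3081 / F-3757, universal closures REFUTED over every index set with a nonarchimedean place**: the
witness on the category of abelian groups `AddCommGrpCat.{u}` with `x₀ := ℤ` (`𝟙_ℤ ≠ 0`).
[cite: MochizukiAbsTopIII2015, Cor 5.5 (iii) p. 131] -/
theorem exists_not_cor55ObservablesTS (v₀ : Vmod) (hv₀ : isArc v₀ = false) :
    ∃ (L : LogFrobeniusSetting Vmod isArc) (T : L.TSHomotopies), ¬ L.Cor55ObservablesTS T ∧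
      ¬ L.Cor55ObservablesCompatible T ∧ ¬ L.Cor55ObservablesTelecoreCompatible T := by
  have hx₀ : (𝟙 (AddCommGrpCat.of (ULift.{u} ℤ)) : _ ⟶ _) ≠ 0 := by
    intro h
    have h1 := congrArg (fun f : AddCommGrpCat.of (ULift.{u} ℤ) ⟶ AddCommGrpCat.of (ULift.{u} ℤ) =>
      (f.hom (ULift.up 1)).down) h
    simp at h1
  obtain ⟨L, T, -, h₁, h₂, h₃⟩ :=
    exists_not_cor55ObservablesTS_of_preadditive Vmod isArc AddCommGrpCat.{u} _ hx₀ v₀ hv₀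
  exact ⟨L, T, h₁, h₂, h₃⟩

/-- **F-3080 as a closed statement is false**: not every `(L, T)` carries the `TS`-valued observables `S_log` of Cor 5.5
(iii) as typed (index set one nonarchimedean place); the row is an ASSUMPTION on `(L, T)` whose interface-level
content is the `TS` ι-diamond law (`TSHomotopies.iota_diamond_of_isLogObservableTS`).
[cite: MochizukiAbsTopIII2015, Cor 5.5 (iii) p. 131] -/
theorem not_forall_cor55ObservablesTS :
    ¬ ∀ (Vmod : Type u) (isArc : Vmod → Bool) (L : LogFrobeniusSetting Vmod isArc) (T : L.TSHomotopies),
      L.Cor55ObservablesTS T := by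
  intro h
  obtain ⟨L, T, hL, -⟩ := exists_not_cor55ObservablesTS PUnit.{u + 1} (fun _ => false) PUnit.unit rfl
  exact hL (h _ _ L T)

/-- **F-3081 as a closed statement is false** (Cor 5.5 (iii), last sentence, typed for the cores in `D•⊢`).
[cite: MochizukiAbsTopIII2015, Cor 5.5 (iii) p. 131] -/
theorem not_forall_cor55ObservablesCompatible :
    ¬ ∀ (Vmod : Type u) (isArc : Vmod → Bool) (L : LogFrobeniusSetting Vmod isArc) (T : L.TSHomotopies),
      L.Cor55ObservablesCompatible T := by
  intro h
  obtain ⟨L, T, -, hL, -⟩ := exists_not_cor55ObservablesTS PUnit.{u + 1} (fun _ => false) PUnit.unit rfl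
  exact hL (h _ _ L T)

/-- **F-3757 as a closed statement is false** (Cor 5.5 (iii), last sentence, typed inside the telecore diagram `D_{An•}`).
[cite: MochizukiAbsTopIII2015, Cor 5.5 (iii) p. 131] -/
theorem not_forall_cor55ObservablesTelecoreCompatible :
    ¬ ∀ (Vmod : Type u) (isArc : Vmod → Bool) (L : LogFrobeniusSetting Vmod isArc) (T : L.TSHomotopies),
      L.Cor55ObservablesTelecoreCompatible T := by
  intro h
  obtain ⟨L, T, -, -, hL⟩ := exists_not_cor55ObservablesTS PUnit.{u + 1} (fun _ => false) PUnit.unit rfl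
  exact hL (h _ _ L T)

end LogFrobeniusSetting

end Literature.AnabelianGeometry.AbsoluteAnabelian
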